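import Summits.RiemannHypothesis.Statement
import Literature.NumberTheory.LFunctions.JensenPolyaProofs
import Literature.NumberTheory.LFunctions.XiMoments
import Literature.Barriers.RiemannHypothesis.JensenPolynomialsRowZeroObstruction
import Literature.Analysis.Complex.JensenLaguerreFlow
import Summits.RiemannHypothesis.RiemannHypothesis.Theorems.Splittings.JointPoly
import HarnessLib

/-!
# X-4 «DERIVATIVE–LAGUERRE» splitting of the Pólya–Jensen criterion (card SPLIT-jen-neg §3) — cell `rh-split`

HONEST LABEL: «SPLITTING SEARCH over kernel-typed RH-EQUIVALENCES; a splitting A ∧ B ⟹ RH is CONDITIONAL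
bookkeeping unless A and B are both proved; nothing here bears on the truth of RH.»  CLASS-(a) CANDIDATE: both
conjuncts are RH-IMPLIED and OPEN; neither is known to imply RH alone; verdict UNDECIDED; conditional bookkeeping;
not a claim about RH.

`E_jen`: `RH ⟺ ∀ d n, J^{d,n}_γ hyperbolic` (`polya_jensen_holds`, `γ = xiTaylorCoeff`), and ROW `0` alone suffices
(`Literature.Barriers.RiemannHypothesis.riemannHypothesis_of_forall_splits_jensenPoly_rowZero`).  The splitting
(seat rh-split-jen-neg, replayed by rh-split-typer-1; referee audit pending):

* A = «ROWS `n ≥ 1`»: every `J^{d,n}_γ` with `n ≥ 1` is hyperbolic (⟺ row `1` ⟺ `G′ ∈ 𝓛𝓟`; implied by RH and by GRH-type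
  `RH₁`; NOT known to imply RH — Farmer's witnesses have all rows `n ≥ 1` hyperbolic and a non-real zero);
* B = «STRICT LAGUERRE SIGN LAW ON ROW `0`»: at every real critical point `x` of `J^{d,0}_γ` (`d ≥ 2`) that is not a
  zero, `J^{d,0}_γ(x) · (J^{d,0}_γ)″(x) < 0` (no positive local minimum / negative local maximum / degenerate critical
  value; implied by RH via the strict Laguerre inequality `p′² − p p″ > 0` off the zeros of a real-rooted `p`,
  PROVED here: `rowZeroLaguerre_of_rh`; not a cell set, so the index no-go `rh_of_jensenShiftZero_infinite` does not
  touch it);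
* GLUE `JointPoly` (RH-FREE, pure polynomial real analysis): «if `p′` is real-rooted and `p·p″ < 0` at every critical
  point of `p` off its zeros, then `p` is real-rooted».  TRUE on paper (card §3.3; typer's M/Z root count); its
  kernel proof (target T-J1) LANDED as `Theorems/Splittings/JointPoly.lean` (seat rh-split-jen-neg, filed by typer-2, p461741:
  `JointPoly.splits_of_derivative_splits_of_laguerre`), so the glue is a THEOREM and the splitting below is
  HYPOTHESIS-FREE: `rh_of_rowsFromOne_of_rowZeroLaguerre : A → B → RH` and `rh_iff_rowsFromOne_and_rowZeroLaguerre : RH ↔ A ∧ B`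
  (both kernel, standard axioms).  The `hJ`-explicit forms are kept as `…_of_jointPoly` for the record.
  Row `0` in degree `d ≥ 2` is recovered from `(J^{d,0})′ = d·J^{d-1,1}` (hyperbolic by A) and B via `hJ`.

All statements in RAW quantified form (no `def`).  Inside this namespace the bare token `RiemannHypothesis` is
`Summit.RiemannHypothesis`; Mathlib's is `_root_.RiemannHypothesis`.
-/

noncomputable section

-- D-0017: `Summit.<S>.<S>.…` is the designed namespace of a single-problem summit.
set_option linter.dupNamespace false

open Polynomial
open Literature.NumberTheory.LFunctions Literature.Barriers.RiemannHypothesis Literature.Analysis.Complex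

namespace Summit.RiemannHypothesis.RiemannHypothesis.Theorems.Splittings.JensenDerivativeLaguerre

/-! ## §1 The strict Laguerre inequality off the zeros of a real-rooted polynomial, and `RH ⟹ B` -/

/-- Strict Laguerre for a monic product over a NON-EMPTY multiset of real roots, off its zeros:
`P′(x)² − P(x)P″(x) > 0` whenever `P(x) ≠ 0` (`= P(x)² Σ 1/(x−aᵢ)²`).  Induction on the multiset:
`P = (X−a)Q`, `t = x − a`: `P′² − PP″ = Q² + t²(Q′² − QQ″)`. [folklore] -/
theorem laguerre_strict_prod (s : Multiset ℝ) (hs : s ≠ 0) (x : ℝ)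
    (hx : ((s.map (fun a => X - C a)).prod).eval x ≠ 0) :
    0 < ((derivative (s.map (fun a => X - C a)).prod).eval x) ^ 2 -
      (s.map (fun a => X - C a)).prod.eval x * (derivative (derivative (s.map (fun a => X - C a)).prod)).eval x := by
  induction s using Multiset.induction_on with
  | empty => exact absurd rfl hs
  | cons a s ih =>
    set Q : ℝ[X] := (s.map (fun a => X - C a)).prod with hQ
    have hP : ((a ::ₘ s).map (fun a => X - C a)).prod = (X - C a) * Q := by
      rw [Multiset.map_cons, Multiset.prod_cons]
    have hd1 : derivative ((X - C a) * Q) = Q + (X - C a) * derivative Q := by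
      rw [derivative_mul, derivative_X_sub_C, one_mul]
    have hd2 : derivative (derivative ((X - C a) * Q)) =
        2 * derivative Q + (X - C a) * derivative (derivative Q) := by
      rw [hd1, derivative_add, derivative_mul, derivative_X_sub_C, one_mul]; ring
    rw [hP] at hx ⊢
    rw [hd2, hd1]
    simp only [eval_add, eval_mul, eval_sub, eval_X, eval_C, eval_ofNat] at hx ⊢
    have hQx : Q.eval x ≠ 0 := fun h ↦ hx (by rw [h, mul_zero])
    have hQsq : 0 < (Q.eval x) ^ 2 := lt_of_le_of_ne (sq_nonneg _) (Ne.symm (pow_ne_zero 2 hQx))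
    -- identity: P′² − PP″ = Q² + t²(Q′² − QQ″)
    have hid : ∀ t e0 e1 e2 : ℝ,
        (e0 + t * e1) ^ 2 - t * e0 * (2 * e1 + t * e2) = e0 ^ 2 + t ^ 2 * (e1 ^ 2 - e0 * e2) := by
      intro t e0 e1 e2; ring
    rw [hid]
    rcases eq_or_ne s 0 with rfl | hs0
    · have hQ1 : Q = 1 := by rw [hQ]; simp
      rw [hQ1]
      simp
    · have ih' := ih hs0 hQx
      nlinarith [sq_nonneg (x - a), ih', mul_nonneg (sq_nonneg (x - a)) ih'.le]

/-- **Strict Laguerre inequality**: if the real polynomial `p` splits over `ℝ`, has `natDegree ≥ 1`, and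
`p(x) ≠ 0`, then `p′(x)² − p(x)·p″(x) > 0`. [folklore] -/
theorem laguerre_strict_of_splits {p : ℝ[X]} (hp : p.Splits) (hdeg : 1 ≤ p.natDegree) {x : ℝ}
    (hx : p.eval x ≠ 0) :
    0 < ((derivative p).eval x) ^ 2 - p.eval x * (derivative (derivative p)).eval x := by
  have hrepr := hp.eq_prod_roots
  set lc : ℝ := p.leadingCoeff with hlc
  set P : ℝ[X] := (p.roots.map (X - C ·)).prod with hP
  have hk : p.natDegree = Multiset.card p.roots := hp.natDegree_eq_card_roots
  have hs : p.roots ≠ 0 := by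
    intro h0; rw [h0, Multiset.card_zero] at hk; omega
  have hp0 : p ≠ 0 := fun h ↦ hx (by simp [h])
  have hlc0 : lc ≠ 0 := leadingCoeff_ne_zero.2 hp0
  have h0 : p.eval x = lc * P.eval x := by rw [hrepr]; simp [eval_mul]
  have h1 : (derivative p).eval x = lc * (derivative P).eval x := by
    rw [hrepr, derivative_C_mul]; simp [eval_mul]
  have h2 : (derivative (derivative p)).eval x = lc * (derivative (derivative P)).eval x := by
    rw [hrepr, derivative_C_mul, derivative_C_mul]; simp [eval_mul]
  have hPx : P.eval x ≠ 0 := fun h ↦ hx (by rw [h0, h, mul_zero])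
  have hcore := laguerre_strict_prod p.roots hs x hPx
  rw [h0, h1, h2]
  have : (lc * (derivative P).eval x) ^ 2 - lc * P.eval x * (lc * (derivative (derivative P)).eval x) =
      lc ^ 2 * (((derivative P).eval x) ^ 2 - P.eval x * (derivative (derivative P)).eval x) := by ring
  rw [this]
  exact mul_pos (lt_of_le_of_ne (sq_nonneg lc) (Ne.symm (pow_ne_zero 2 hlc0))) hcore

/-- **RH ⟹ B** (the strict Laguerre sign law on row `0`): under RH every `J^{d,0}_γ` is real-rooted
(`polya_jensen_holds`) of degree `d` (`γ(d) > 0`), so at a critical point off its zeros `−J·J″ = J′² − J·J″ > 0`.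
[cite: CravenCsordas1989, §1 (the Laguerre inequality)] -/
theorem rowZeroLaguerre_of_rh (hRH : _root_.RiemannHypothesis) :
    ∀ d : ℕ, 2 ≤ d → ∀ x : ℝ, (derivative (jensenPoly xiTaylorCoeff d 0)).eval x = 0 →
      (jensenPoly xiTaylorCoeff d 0).eval x ≠ 0 →
      (jensenPoly xiTaylorCoeff d 0).eval x * (derivative (derivative (jensenPoly xiTaylorCoeff d 0))).eval x < 0 := by
  intro d hd x hcrit hne
  have hsplit : (jensenPoly xiTaylorCoeff d 0).Splits := (polya_jensen_holds.1 hRH) d 0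
  have hdeg : (jensenPoly xiTaylorCoeff d 0).natDegree = d :=
    natDegree_jensenPoly xiTaylorCoeff d 0 (by rw [zero_add]; exact (xiTaylorCoeff_pos_holds d).ne')
  have h := laguerre_strict_of_splits hsplit (by omega) hne
  rw [hcrit] at h
  nlinarith [h]

/-- **RH ⟹ A** (rows `n ≥ 1` are hyperbolic; in fact all rows). [cite: GORZPNAS2019, §1] -/
theorem rowsFromOne_of_rh (hRH : _root_.RiemannHypothesis) :
    ∀ d n : ℕ, 1 ≤ n → (jensenPoly xiTaylorCoeff d n).Splits :=
  fun d n _ ↦ (polya_jensen_holds.1 hRH) d n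

/-! ## §2 The splitting `A ∧ B ⟹ RH`, kernel MODULO the RH-free glue `JointPoly` (explicit hypothesis `hJ`) -/

/-- X-4 with the glue as an EXPLICIT hypothesis `hJ` (record of the pre-T-J1 state; superseded by the hypothesis-free
`rh_of_rowsFromOne_of_rowZeroLaguerre` below): given the RH-free polynomial lemma `JointPoly` as `hJ`, the two
RH-implied conjuncts A (rows `n ≥ 1` hyperbolic) and B (strict Laguerre sign law on row `0`) give RH — row `0` in
degree `d ≥ 2` via `(J^{d,0})′ = d·J^{d-1,1}` (`JensenLaguerreFlow.derivative_jensenPoly_succ`) and `hJ`, degrees `≤ 1`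
trivially, then `riemannHypothesis_of_forall_splits_jensenPoly_rowZero`.  BOTH `hA` and `hB` are consumed.
CONDITIONAL bookkeeping (on `hJ`; and A, B are open); not a claim about RH. [cite: GORZPNAS2019, §1] -/
theorem rh_of_rowsFromOne_of_rowZeroLaguerre_of_jointPoly
    (hJ : ∀ p : ℝ[X], (derivative p).Splits →
      (∀ x : ℝ, (derivative p).eval x = 0 → p.eval x ≠ 0 → p.eval x * (derivative (derivative p)).eval x < 0) →
      p.Splits)
    (hA : ∀ d n : ℕ, 1 ≤ n → (jensenPoly xiTaylorCoeff d n).Splits)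
    (hB : ∀ d : ℕ, 2 ≤ d → ∀ x : ℝ, (derivative (jensenPoly xiTaylorCoeff d 0)).eval x = 0 →
      (jensenPoly xiTaylorCoeff d 0).eval x ≠ 0 →
      (jensenPoly xiTaylorCoeff d 0).eval x * (derivative (derivative (jensenPoly xiTaylorCoeff d 0))).eval x < 0) :
    _root_.RiemannHypothesis := by
  apply riemannHypothesis_of_forall_splits_jensenPoly_rowZero
  intro d
  rcases Nat.lt_or_ge d 2 with hd | hd
  · exact Splits.of_natDegree_le_one ((Literature.NumberTheory.LFunctions.natDegree_jensenPoly_le _ d 0).trans (by omega))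
  · obtain ⟨e, rfl⟩ := Nat.exists_eq_add_of_le' hd
    refine hJ _ ?_ (hB _ hd)
    rw [JensenLaguerreFlow.derivative_jensenPoly_succ]
    exact (hA (e + 1) (0 + 1) (by norm_num)).C_mul _

/-- X-4 as an equivalence with the glue as an explicit hypothesis (record; superseded below). [cite: GORZPNAS2019, §1] -/
theorem rh_iff_rowsFromOne_and_rowZeroLaguerre_of_jointPoly
    (hJ : ∀ p : ℝ[X], (derivative p).Splits →
      (∀ x : ℝ, (derivative p).eval x = 0 → p.eval x ≠ 0 → p.eval x * (derivative (derivative p)).eval x < 0) →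
      p.Splits) :
    _root_.RiemannHypothesis ↔
      (∀ d n : ℕ, 1 ≤ n → (jensenPoly xiTaylorCoeff d n).Splits) ∧
      (∀ d : ℕ, 2 ≤ d → ∀ x : ℝ, (derivative (jensenPoly xiTaylorCoeff d 0)).eval x = 0 →
        (jensenPoly xiTaylorCoeff d 0).eval x ≠ 0 →
        (jensenPoly xiTaylorCoeff d 0).eval x * (derivative (derivative (jensenPoly xiTaylorCoeff d 0))).eval x < 0) :=
  ⟨fun h ↦ ⟨rowsFromOne_of_rh h, rowZeroLaguerre_of_rh h⟩,
    fun ⟨hA, hB⟩ ↦ rh_of_rowsFromOne_of_rowZeroLaguerre_of_jointPoly hJ hA hB⟩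

/-! ## §3 HYPOTHESIS-FREE: the glue `JointPoly` is the tree theorem `JointPoly.splits_of_derivative_splits_of_laguerre` -/

/-- **X-4 DERIVATIVE–LAGUERRE splitting, kernel and hypothesis-free** (card SPLIT-jen-neg §3; seat rh-split-jen-neg, glue
T-J1 landed p461741, `RH ⟹ B` via the strict Laguerre inequality above): A («every `J^{d,n}_γ` with `n ≥ 1` is
hyperbolic») and B («strict Laguerre sign law `J·J″ < 0` at the real critical points of every `J^{d,0}_γ`, `d ≥ 2`, off
its zeros») TOGETHER give RH.  Both binders are consumed; A and B are each RH-IMPLIED and OPEN; neither is known to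
imply RH alone (CLASS-(a) candidate, verdict UNDECIDED; conditional bookkeeping in the sense that A and B are unproved;
nothing here bears on the truth of RH). [cite: GORZPNAS2019, §1] -/
theorem rh_of_rowsFromOne_of_rowZeroLaguerre
    (hA : ∀ d n : ℕ, 1 ≤ n → (jensenPoly xiTaylorCoeff d n).Splits)
    (hB : ∀ d : ℕ, 2 ≤ d → ∀ x : ℝ, (derivative (jensenPoly xiTaylorCoeff d 0)).eval x = 0 →
      (jensenPoly xiTaylorCoeff d 0).eval x ≠ 0 →
      (jensenPoly xiTaylorCoeff d 0).eval x * (derivative (derivative (jensenPoly xiTaylorCoeff d 0))).eval x < 0) :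
    _root_.RiemannHypothesis :=
  rh_of_rowsFromOne_of_rowZeroLaguerre_of_jointPoly JointPoly.splits_of_derivative_splits_of_laguerre hA hB

/-- **X-4 as a kernel equivalence**: `RH ⟺ A ∧ B` (A = rows `n ≥ 1` hyperbolic, B = strict Laguerre sign law on row
`0`), hypothesis-free, standard axioms.  CLASS-(a) candidate; UNDECIDED; nothing here bears on the truth of RH.
[cite: GORZPNAS2019, §1] -/
theorem rh_iff_rowsFromOne_and_rowZeroLaguerre :
    _root_.RiemannHypothesis ↔
      (∀ d n : ℕ, 1 ≤ n → (jensenPoly xiTaylorCoeff d n).Splits) ∧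
      (∀ d : ℕ, 2 ≤ d → ∀ x : ℝ, (derivative (jensenPoly xiTaylorCoeff d 0)).eval x = 0 →
        (jensenPoly xiTaylorCoeff d 0).eval x ≠ 0 →
        (jensenPoly xiTaylorCoeff d 0).eval x * (derivative (derivative (jensenPoly xiTaylorCoeff d 0))).eval x < 0) :=
  ⟨fun h ↦ ⟨rowsFromOne_of_rh h, rowZeroLaguerre_of_rh h⟩, fun ⟨hA, hB⟩ ↦ rh_of_rowsFromOne_of_rowZeroLaguerre hA hB⟩

end Summit.RiemannHypothesis.RiemannHypothesis.Theorems.Splittings.JensenDerivativeLaguerre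

end
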